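import Summits.Langlands.Langlands.Theses.ParityBlindBianchi
import Summits.Langlands.Langlands.Theorems.ParityBlindBianchiIcosahedralDescentLevelMain
import Summits.Langlands.Langlands.Theorems.IcosahedralDescentLevel.Negative.DoorOfInhabited

/-!
# `IcosahedralDescentLevelBC` (stmt-Langlands-16852, D″ of route ParityBlindBianchi): the repair
# `0 ∉ S₀` is load-bearing and complete in the BC form, and any kill refutes a base-change fact

Negative-side lemmas (refuter, cdisprove cycle 1, 2026-08-17; supports stmt-Langlands-16852).
The crux is `QuadraticDescentGL2 → QuadraticBaseChangeGL2 → IcosahedralDescentLevelR`: uniform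
quadratic descent `ℚ ← K` for an irreducible icosahedral `ρ` over all 2-split imaginary quadratic
`K`, with the bad set `S₀` required to omit `0`, behind the promoted in-print cruxes QD / QBC.

* `withoutH0_iff` — deleting `0 ∉ S₀` (i.e. putting the refuted-misstated sibling
  `IcosahedralDescentLevel`, D′, behind the same antecedents) is EXACTLY adding the door:
  `(QD → QBC → D′) ↔ D″BC ∧ (QD → QBC → Door)`, the door being "strong Artin for every irreducible
  icosahedral `ρ/ℚ`, odd or even, from a 2-adic model and SOME cuspidal datum per field" (sibling
  `DoorOfInhabited`, p98657).  So `0 ∉ S₀` is the one load-bearing side condition of the crux and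
  the repair is complete for the BC form as well.
* `allParity_of_withoutH0_of_inhabited` — what the deletion smuggles in: granted QD, QBC and the
  bare existence of one cuspidal datum of `GL₂` over each 2-split imaginary quadratic field, the
  un-repaired statement proves strong Artin for EVERY irreducible icosahedral `ρ/ℚ` — the route's
  open rank-0 target with its evenness hypothesis deleted.
* `not_icosahedralDescentLevelBC_imp` — WHY NO KILL EXISTS: the tree derives the crux from the four
  Arthur–Clozel named facts (p125164; the antecedents are not even used), so a refutation of the
  crux refutes `cuspidal_descent_cyclic ∧ ArthurClozel1989_strongLifting_unramified ∧
  baseChange_cyclic_cuspidal ∧ ArthurClozel_fibres_quadratic` as typed (A–C III.4.2 (d), 5.1,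
  4.2 (a), 3.1), and unpacks to a failure of quadratic descent in the presence of quadratic descent
  (`not_icosahedralDescentLevelBC_shape`).

No statement of the route is asserted positively: conclusions are an equivalence, all-parity Artin
(no parity hypothesis: not a route decl), and negations.
-/

-- `Summit.Langlands.Langlands.…`: the repeated path component is the tree's layout (D-0017).
set_option linter.dupNamespace false

namespace Summit.Langlands.Langlands.Theorems.IcosahedralDescentLevelBC.Negative

open scoped NumberField
open NumberField IsDedekindDomain Field Filter
open Literature.NumberTheory.Automorphic Literature.NumberTheory.GaloisRepresentations
open Summit.Langlands.Langlands.Theses.ParityBlindBianchi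
open Summit.Langlands.Langlands.Theorems.IcosahedralDescentLevel.Negative

/-- **`0 ∉ S₀` is load-bearing and its repair is complete (BC form).**  Deleting `0 ∉ S₀` from the
crux gives `QD → QBC → IcosahedralDescentLevel` (the vestigial D′ behind the same antecedents), and
`(QD → QBC → D′) ↔ IcosahedralDescentLevelBC ∧ (QD → QBC → Door)`, the Door (spelled out: strong
Artin a.e. for every irreducible icosahedral `ρ/ℚ` from a 2-adic model and SOME cuspidal datum per
2-split imaginary quadratic `K`, no compatibility) being the second conjunct of the sibling
decomposition `D′ ↔ D″ ∧ Door` (p98657), whose first conjunct is `IcosahedralDescentLevelR`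
verbatim; pure logic over it. [folklore] -/
theorem withoutH0_iff :
    (QuadraticDescentGL2 → QuadraticBaseChangeGL2 → IcosahedralDescentLevel) ↔
      IcosahedralDescentLevelBC ∧
        (QuadraticDescentGL2 → QuadraticBaseChangeGL2 →
        (∀ (ι : PadicAlgCl 2 ≃+* ℂ) (ρ : FramedGaloisRep ℚ ℂ 2), ρ.toGaloisRep.IsIrreducible →
          Nonempty ((Matrix.ProjGenLinGroup.mk.comp ρ.toMonoidHom).range ≃* alternatingGroup (Fin 5)) →
          (∀ (K : Type) [Field K] [NumberField K], NumberField.IsTotallyComplex K →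
            Module.finrank ℚ K = 2 →
            (∃ v w : HeightOneSpectrum (𝓞 K), v ≠ w ∧ ((2 : ℕ) : 𝓞 K) ∈ v.asIdeal ∧
              ((2 : ℕ) : 𝓞 K) ∈ w.asIdeal) →
            ∃ (σ : FramedGaloisRep K (PadicAlgCl 2) 2) (hcpt : isCompact_glFiniteIntegralLevel 2 K)
              (_π : CuspidalAutomorphicRepData 2 K hcpt),
              ∀ (g : absoluteGaloisGroup K) (i j : Fin 2),
                ι ((σ g).val i j) = ((FramedGaloisRep.restrictField K ρ) g).val i j) →
          ∃ (hcpt : isCompact_glFiniteIntegralLevel 2 ℚ) (π : CuspidalAutomorphicRepData 2 ℚ hcpt),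
            ∀ᶠ v : HeightOneSpectrum (𝓞 ℚ) in cofinite, ∃ α : Multiset ℂ,
              π.1.HasSatakeParamAt v α ∧ ρ.IsUnramifiedAt v ∧
                ρ.HasFrobCharpolyAt v (satakePolynomial α))) := by
  have key := icosahedralDescentLevel_iff_repaired_and_door
  constructor
  · intro h
    exact ⟨fun hQD hQBC => (key.mp (h hQD hQBC)).1, fun hQD hQBC => (key.mp (h hQD hQBC)).2⟩
  · rintro ⟨hcrux, hdoor⟩ hQD hQBC
    exact key.mpr ⟨hcrux hQD hQBC, hdoor hQD hQBC⟩

/-- **What the deletion smuggles in.**  Granted QD, QBC and one cuspidal automorphic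
representation datum of `GL₂` over each 2-split imaginary quadratic field (true, not constructible
in the tree), the un-repaired statement yields strong Artin (a.e.) for EVERY irreducible
`ρ : Γ_ℚ →ₜ* GL₂(ℂ)` with projective image `A₅` — NO parity hypothesis (sibling p98657
`allParity_of_descent_of_inhabited`, re-glued over the antecedents). [folklore] -/
theorem allParity_of_withoutH0_of_inhabited
    (h : QuadraticDescentGL2 → QuadraticBaseChangeGL2 → IcosahedralDescentLevel)
    (hQD : QuadraticDescentGL2) (hQBC : QuadraticBaseChangeGL2)
    (hinh : ∀ (K : Type) [Field K] [NumberField K], NumberField.IsTotallyComplex K →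
      Module.finrank ℚ K = 2 →
      (∃ v w : HeightOneSpectrum (𝓞 K), v ≠ w ∧ ((2 : ℕ) : 𝓞 K) ∈ v.asIdeal ∧
        ((2 : ℕ) : 𝓞 K) ∈ w.asIdeal) →
      ∃ hcpt : isCompact_glFiniteIntegralLevel 2 K, Nonempty (CuspidalAutomorphicRepData 2 K hcpt))
    (ρ : FramedGaloisRep ℚ ℂ 2) (hirr : ρ.toGaloisRep.IsIrreducible)
    (hA5 : Nonempty ((Matrix.ProjGenLinGroup.mk.comp ρ.toMonoidHom).range ≃*
      alternatingGroup (Fin 5))) :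
    ∃ (hcpt : isCompact_glFiniteIntegralLevel 2 ℚ) (π : CuspidalAutomorphicRepData 2 ℚ hcpt),
      ∀ᶠ v : HeightOneSpectrum (𝓞 ℚ) in cofinite, ∃ α : Multiset ℂ,
        π.1.HasSatakeParamAt v α ∧ ρ.IsUnramifiedAt v ∧
          ρ.HasFrobCharpolyAt v (satakePolynomial α) :=
  allParity_of_descent_of_inhabited (h hQD hQBC) hinh ρ hirr hA5

/-- **Why no kill exists: a refutation of the crux refutes an Arthur–Clozel fact as typed.**  The
tree derives the crux's conclusion `IcosahedralDescentLevelR` from F1 `cuspidal_descent_cyclic`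
(III.4.2 (d)), F2 `ArthurClozel1989_strongLifting_unramified` (III.5.1), F3
`baseChange_cyclic_cuspidal` (III.4.2 (a)) and F4 `ArthurClozel_fibres_quadratic` (III.3.1)
(p125164, p111861), ignoring the antecedents; contrapositively `¬ crux` negates the conjunction of
the four all-rank named facts. [folklore] -/
theorem not_icosahedralDescentLevelBC_imp (h : ¬ IcosahedralDescentLevelBC) :
    ¬ (cuspidal_descent_cyclic ∧ ArthurClozel1989_strongLifting_unramified ∧
        baseChange_cyclic_cuspidal ∧ ArthurClozel_fibres_quadratic) :=
  fun ⟨h₁, h₂, h₃, h₄⟩ => h fun _ _ =>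
    Summit.Langlands.Langlands.Theorems.IcosahedralDescentLevel.icosahedralDescentLevel_conditional
      h₁ h₂ h₃ h₄

/-- **Shape of a would-be counterexample.**  `¬ crux` says: quadratic descent AND quadratic base
change for `GL₂` hold as typed, yet for some `ι` and some irreducible icosahedral `ρ/ℚ` there is a
bad set `S₀ ∌ 0` with a compatible cuspidal family over every 2-split imaginary quadratic `K`
while NO cuspidal `π` on `GL₂(𝔸_ℚ)` matches `ρ` almost everywhere — descent failing in the
presence of descent. [folklore] -/
theorem not_icosahedralDescentLevelBC_shape (h : ¬ IcosahedralDescentLevelBC) :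
    QuadraticDescentGL2 ∧ QuadraticBaseChangeGL2 ∧
      ∃ (ι : PadicAlgCl 2 ≃+* ℂ) (ρ : FramedGaloisRep ℚ ℂ 2),
        ρ.toGaloisRep.IsIrreducible ∧
        Nonempty ((Matrix.ProjGenLinGroup.mk.comp ρ.toMonoidHom).range ≃* alternatingGroup (Fin 5)) ∧
        (∃ S₀ : Finset ℕ, (0 : ℕ) ∉ S₀ ∧ ∀ (K : Type) [Field K] [NumberField K],
          NumberField.IsTotallyComplex K → Module.finrank ℚ K = 2 →
          (∃ v w : HeightOneSpectrum (𝓞 K), v ≠ w ∧ ((2 : ℕ) : 𝓞 K) ∈ v.asIdeal ∧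
            ((2 : ℕ) : 𝓞 K) ∈ w.asIdeal) →
          ∃ (σ : FramedGaloisRep K (PadicAlgCl 2) 2) (hcpt : isCompact_glFiniteIntegralLevel 2 K)
            (π : CuspidalAutomorphicRepData 2 K hcpt),
            (∀ (g : absoluteGaloisGroup K) (i j : Fin 2),
              ι ((σ g).val i j) = ((FramedGaloisRep.restrictField K ρ) g).val i j) ∧
            ∀ w : HeightOneSpectrum (𝓞 K), (∀ ℓ ∈ S₀, ((ℓ : ℕ) : 𝓞 K) ∉ w.asIdeal) →
              Summit.Langlands.SatakeFrobCompatibleAt ι π.1 σ w) ∧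
        ¬ ∃ (hcpt : isCompact_glFiniteIntegralLevel 2 ℚ) (π : CuspidalAutomorphicRepData 2 ℚ hcpt),
          ∀ᶠ v : HeightOneSpectrum (𝓞 ℚ) in cofinite, ∃ α : Multiset ℂ,
            π.1.HasSatakeParamAt v α ∧ ρ.IsUnramifiedAt v ∧
              ρ.HasFrobCharpolyAt v (satakePolynomial α) := by
  by_contra hc
  apply h
  intro hQD hQBC ι ρ hirr hA5 hS
  by_contra hconc
  exact hc ⟨hQD, hQBC, ι, ρ, hirr, hA5, hS, hconc⟩

end Summit.Langlands.Langlands.Theorems.IcosahedralDescentLevelBC.Negative
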